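import Summits.ValiantsHypothesis.ValiantsHypothesis.Theorems.LacunarySymmetroidMatrixDescartesPivotKillMultiplicity
import Summits.ValiantsHypothesis.ValiantsHypothesis.Theorems.LacunarySymmetroidMatrixDescartesPivotRankOneFourKillEight

/-!
# `MatrixDescartes` census — rank-one `(2,4)₁`, TWO below / TWO above, chamber (B): THE KIT OF THE SUPPORT CERTIFICATES
# (even parity of the `2|2` eleven-nomial, the even bridge, the sharp chord lemma)

HONEST FRAMING.  Object-search cell `pub-symmetroid`, seat `val-sym-mdr-p1` (generation 26); helper file `--supports` the crux item
stmt-ValiantsHypothesis-18050 (`Theses.LacunarySymmetroid.MatrixDescartes`, OPEN, on HOLD) with NO closure claim.  Chamber (B) of the split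
`d₀ < d₁ < e < d₂ < d₃` (degree order `d₀+d₁ < e+d₀ < d₀+d₂ < e+d₁ < d₁+d₂ < 2e < d₀+d₃ < e+d₂ < d₁+d₃ < e+d₃ < d₂+d₃`, Descartes `10`) is, with
chamber (C) of the `1|3` split, the open part of the rank-one law «(2,4)₁ ≤ 8» (tree: `≤ 8` under ten weight-free / circuit certificates,
located-complete; `8` attained).  Here the trailing AND the leading coefficient are positive pair terms, so the number of positive roots with
multiplicity is EVEN (§1 `elevenNomial_twoTwo_even`): «never Descartes-sharp» (`≤ 9` with multiplicity) is «`≤ 8`» (§1 `card_posRoots_le_of_even`).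
§2 `chord_contradiction_sharp`: the chord lemma of `…OneThreeSupportKit` with the closing condition `ρ·R² < KC·(R−1)²` (when the far letter
lies below, `(t₀ − t₂)² ≤ t₂²`), which the chamber-(B) rays need (their close pair is only moderately close).  The support certificates
themselves (`…TwoTwoSupport<TAG>{Rows,Eight}`, generated by the seat's `work/gen_pairB.py`) use rows 4–9 of sharpness, three Farkas rays on
letters 1, 2, 3 (`σ₁₂ ≥ KA`, `σ₂₃ ≤ KB`, `σ₁₃ ≥ KC·σ₁₂`) and this kit.  LOCATED (seat exp/raysB.py): on the support `(10; 0, 4, 13, 21)` the nine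
rows are jointly infeasible with margin 0.75.  Nothing here bears on `MatrixDescartes` in its window, on `DoorA26` / `DoorA34`, registers /
credences, or `VP ≠ VNP`.

[folklore] Descartes' parity [cite: BasuPollackRoy2006, Thm. 2.33] through the tree (`Literature…Descartes.even_countP_roots_pos_iff`);
elementary inequalities.  No definitions, no named facts.
-/

-- `Summit.ValiantsHypothesis.ValiantsHypothesis.…` repeats a component by the D-0017 layout
-- (single-conjunct summit), which the `dupNamespace` linter flags; the name is mandated.
set_option linter.dupNamespace false

namespace Summit.ValiantsHypothesis.ValiantsHypothesis.Theorems.LacunarySymmetroidMatrixDescartes.Pivot.TwoDirections.BlockLaw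

open Polynomial Matrix Finset
open scoped BigOperators
open Summit.ValiantsHypothesis.ValiantsHypothesis.Theorems.LacunarySymmetroidMatrixDescartes.Pivot.KillMult (card_posRoots_le_countP)

/-! ## 1. Even parity of the `2|2` eleven-nomial and the even bridge -/

/-- **An even count bounded by an odd number is bounded by one less**: if the positive roots of `P` counted with multiplicity are even in number
and at most `2j + 1`, then `P` has at most `2j` distinct positive roots. [folklore] -/
theorem card_posRoots_le_of_even (P : ℝ[X]) (j : ℕ) (heven : Even (P.roots.countP (fun x => 0 < x)))
    (hle : P.roots.countP (fun x => 0 < x) ≤ 2 * j + 1) :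
    (P.roots.toFinset.filter (fun t => 0 < t)).card ≤ 2 * j := by
  have h := card_posRoots_le_countP P
  obtain ⟨i, hi⟩ := heven
  omega

/-- **THE `2|2` ELEVEN-NOMIAL HAS AN EVEN NUMBER OF POSITIVE ROOTS (with multiplicity).**  Split `d₀ < d₁ < e < d₂ < d₃` (any chamber): the
trailing term is the pair term `w₀w₁D₀₁·X^{d₀+d₁}` and the leading term the pair term `w₂w₃D₂₃·X^{d₂+d₃}`; if both are positive (letters `0,1`
and `2,3` not parallel), Descartes' parity makes the count even. [cite: BasuPollackRoy2006, Thm. 2.33] -/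
theorem elevenNomial_twoTwo_even (e d₀ d₁ d₂ d₃ : ℕ) (h01 : d₀ < d₁) (h1e : d₁ < e) (he2 : e < d₂) (h23 : d₂ < d₃)
    (dJ m₀ m₁ m₂ m₃ w₀ w₁ w₂ w₃ D01 D02 D03 D12 D13 D23 : ℝ) (htrail : 0 < w₀ * w₁ * D01) (hlead : 0 < w₂ * w₃ * D23) :
    Even ((∑ i : Fin 11, Polynomial.C ((![dJ, w₀ * m₀, w₁ * m₁, w₂ * m₂, w₃ * m₃, w₀ * w₁ * D01, w₀ * w₂ * D02, w₀ * w₃ * D03, w₁ * w₂ * D12, w₁ * w₃ * D13, w₂ * w₃ * D23] : Fin 11 → ℝ) i) * X ^ ((![2 * e, e + d₀, e + d₁, e + d₂, e + d₃, d₀ + d₁, d₀ + d₂, d₀ + d₃, d₁ + d₂, d₁ + d₃, d₂ + d₃] : Fin 11 → ℕ) i)).roots.countP (fun x => 0 < x)) := by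
  classical
  set c : Fin 11 → ℝ := ![dJ, w₀ * m₀, w₁ * m₁, w₂ * m₂, w₃ * m₃, w₀ * w₁ * D01, w₀ * w₂ * D02, w₀ * w₃ * D03, w₁ * w₂ * D12, w₁ * w₃ * D13, w₂ * w₃ * D23] with hc
  set n : Fin 11 → ℕ := ![2 * e, e + d₀, e + d₁, e + d₂, e + d₃, d₀ + d₁, d₀ + d₂, d₀ + d₃, d₁ + d₂, d₁ + d₃, d₂ + d₃] with hn
  have hge : ∀ i, d₀ + d₁ ≤ n i := by
    intro i; fin_cases i <;> simp [hn] <;> omega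
  have hbot : ∀ i, i ≠ (5 : Fin 11) → n i - (d₀ + d₁) ≠ 0 := by
    intro i hi; fin_cases i <;> simp [hn] at hi ⊢ <;> omega
  have hle : ∀ i, n i - (d₀ + d₁) ≤ d₂ + d₃ - (d₀ + d₁) := by
    intro i; fin_cases i <;> simp [hn] <;> omega
  have htop : ∀ i, i ≠ (10 : Fin 11) → n i - (d₀ + d₁) ≠ d₂ + d₃ - (d₀ + d₁) := by
    intro i hi; fin_cases i <;> simp [hn] at hi ⊢ <;> omega
  set Q : ℝ[X] := ∑ i : Fin 11, Polynomial.C (c i) * X ^ (n i - (d₀ + d₁)) with hQ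
  have hP : (∑ i : Fin 11, Polynomial.C (c i) * X ^ n i) = X ^ (d₀ + d₁) * Q := by
    rw [hQ, Finset.mul_sum]
    refine Finset.sum_congr rfl fun i _ => ?_
    rw [mul_left_comm, ← pow_add, Nat.add_sub_cancel' (hge i)]
  have hQ0 : Q.coeff 0 = w₀ * w₁ * D01 := by
    rw [hQ, finsetSum_coeff, Finset.sum_eq_single (5 : Fin 11)]
    · have h1 : n 5 = d₀ + d₁ := by simp [hn]
      have c1 : c 5 = w₀ * w₁ * D01 := by simp [hc]
      rw [h1, c1, Nat.sub_self, coeff_C_mul_X_pow, if_pos rfl]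
    · intro i _ hi
      rw [coeff_C_mul_X_pow, if_neg (fun h => hbot i hi h.symm)]
    · intro h; exact absurd (Finset.mem_univ _) h
  have hQN : Q.coeff (d₂ + d₃ - (d₀ + d₁)) = w₂ * w₃ * D23 := by
    rw [hQ, finsetSum_coeff, Finset.sum_eq_single (10 : Fin 11)]
    · have h10 : n 10 = d₂ + d₃ := by simp [hn]
      have c10 : c 10 = w₂ * w₃ * D23 := by simp [hc]
      rw [h10, c10, coeff_C_mul_X_pow, if_pos rfl]
    · intro i _ hi
      rw [coeff_C_mul_X_pow, if_neg (fun h => htop i hi h.symm)]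
    · intro h; exact absurd (Finset.mem_univ _) h
  have hdeg : Q.natDegree ≤ d₂ + d₃ - (d₀ + d₁) := by
    rw [hQ]
    refine Polynomial.natDegree_sum_le_of_forall_le _ _ fun i _ => ?_
    exact (natDegree_C_mul_X_pow_le (c i) _).trans (hle i)
  have hnat : Q.natDegree = d₂ + d₃ - (d₀ + d₁) :=
    Polynomial.natDegree_eq_of_le_of_coeff_ne_zero hdeg (by rw [hQN]; exact hlead.ne')
  have hleadQ : 0 < Q.leadingCoeff := by
    rw [Polynomial.leadingCoeff, hnat, hQN]; exact hlead
  have hQ0' : Q.coeff 0 ≠ 0 := by rw [hQ0]; exact htrail.ne'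
  have hQne : Q ≠ 0 := by rintro h; rw [h] at hQ0'; simp at hQ0'
  have hXk : (X : ℝ[X]) ^ (d₀ + d₁) ≠ 0 := pow_ne_zero _ X_ne_zero
  have hroots : (∑ i : Fin 11, Polynomial.C (c i) * X ^ n i).roots.countP (fun x => 0 < x) = Q.roots.countP (fun x => 0 < x) := by
    rw [hP, roots_mul (mul_ne_zero hXk hQne), roots_X_pow, Multiset.countP_add]
    suffices h : Multiset.countP (fun x : ℝ => 0 < x) ((d₀ + d₁) • ({0} : Multiset ℝ)) = 0 by rw [h, zero_add]
    rw [Multiset.countP_eq_zero]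
    intro a ha
    rw [Multiset.mem_nsmul] at ha
    rw [Multiset.mem_singleton.1 ha.2]
    exact lt_irrefl 0
  rw [hroots, Literature.Algebra.Polynomial.Descartes.even_countP_roots_pos_iff hQ0', hQ0]
  exact mul_pos hleadQ htrail

/-! ## 2. The sharp chord lemma -/


/-- **THE SHARP CHORD LEMMA.**  Positive `t₀, t₁, t₂`; `KA·t₀t₁ ≤ (t₀−t₁)²`, `(t₁−t₂)² ≤ KB·t₁t₂`, `KC·(t₀−t₁)²·t₂ ≤ (t₀−t₂)²·t₁`; constants with
`0 < KA`, `1 ≤ ρ ≤ R`, `(R−1)² ≤ KA·R`, `KB·ρ ≤ (ρ−1)²`, `ρ·R² < KC(R−1)²` ⇒ `False`. [folklore] -/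
theorem chord_contradiction_sharp (t₀ t₁ t₂ KA KB KC R ρ : ℝ) (ht₀ : 0 < t₀) (ht₁ : 0 < t₁) (ht₂ : 0 < t₂)
    (hKA : 0 < KA) (hR : 1 ≤ R) (hRA : (R - 1) ^ 2 ≤ KA * R) (hρ : 1 ≤ ρ) (hρB : KB * ρ ≤ (ρ - 1) ^ 2) (hρR : ρ ≤ R)
    (hKC : ρ * R ^ 2 < KC * (R - 1) ^ 2)
    (hA : KA * (t₀ * t₁) ≤ (t₀ - t₁) ^ 2) (hB : (t₁ - t₂) ^ 2 ≤ KB * (t₁ * t₂))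
    (hC : KC * ((t₀ - t₁) ^ 2 * t₂) ≤ (t₀ - t₂) ^ 2 * t₁) : False := by
  have hKC0 : 0 < KC := by
    have h1 : 0 < ρ * R ^ 2 := by positivity
    exact pos_of_mul_pos_left (lt_trans h1 hKC) (sq_nonneg _)
  have a1 : t₁ ≤ ρ * t₁ := le_mul_of_one_le_left ht₁.le hρ
  have a2 : t₂ ≤ ρ * t₂ := le_mul_of_one_le_left ht₂.le hρ
  -- (1) letters 1, 2 close: t₂ ≤ ρ t₁ and t₁ ≤ ρ t₂
  have key : (ρ * t₁ - t₂) * (t₁ - ρ * t₂) ≤ 0 := by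
    have e : (ρ * t₁ - t₂) * (t₁ - ρ * t₂) = ρ * (t₁ - t₂) ^ 2 - (ρ - 1) ^ 2 * (t₁ * t₂) := by ring
    rw [e]
    nlinarith [mul_le_mul_of_nonneg_left hB (by linarith : (0 : ℝ) ≤ ρ),
      mul_le_mul_of_nonneg_right hρB (mul_pos ht₁ ht₂).le]
  have hU : t₂ ≤ ρ * t₁ := by
    by_contra h
    push Not at h
    have hneg : ρ * t₁ - t₂ < 0 := by linarith
    have h2 : 0 ≤ t₁ - ρ * t₂ := by
      by_contra h'
      push Not at h'
      nlinarith [mul_pos_of_neg_of_neg hneg h']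
    linarith
  have hL : t₁ ≤ ρ * t₂ := by
    by_contra h
    push Not at h
    have hpos' : 0 < t₁ - ρ * t₂ := by linarith
    have h2 : ρ * t₁ - t₂ ≤ 0 := by
      by_contra h'
      push Not at h'
      nlinarith [mul_pos h' hpos']
    linarith
  -- (2) letters 0, 1 far
  have keyA : 0 ≤ (R * t₀ - t₁) * (t₀ - R * t₁) := by
    have e : (R * t₀ - t₁) * (t₀ - R * t₁) = R * (t₀ - t₁) ^ 2 - (R - 1) ^ 2 * (t₀ * t₁) := by ring
    rw [e]
    nlinarith [mul_le_mul_of_nonneg_left hA (by linarith : (0 : ℝ) ≤ R),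
      mul_le_mul_of_nonneg_right hRA (mul_pos ht₀ ht₁).le]
  have hne : t₀ ≠ t₁ := by
    intro h
    rw [h] at hA
    have : 0 < KA * (t₁ * t₁) := by positivity
    nlinarith
  have b0 : t₀ ≤ R * t₀ := le_mul_of_one_le_left ht₀.le hR
  have b1 : t₁ ≤ R * t₁ := le_mul_of_one_le_left ht₁.le hR
  rcases le_or_gt t₁ t₀ with h10 | h10
  · -- t₁ ≤ t₀, so t₀ ≥ R t₁
    have hlt : t₁ < t₀ := lt_of_le_of_ne h10 (Ne.symm hne)
    have hpos : 0 < R * t₀ - t₁ := by linarith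
    have hR0 : R * t₁ ≤ t₀ := by
      by_contra h
      push Not at h
      nlinarith [mul_pos hpos (by linarith : 0 < R * t₁ - t₀)]
    have h1 : (R - 1) * t₀ ≤ R * (t₀ - t₁) := by linarith
    have h1' : ((R - 1) * t₀) ^ 2 ≤ (R * (t₀ - t₁)) ^ 2 :=
      pow_le_pow_left₀ (mul_nonneg (by linarith) ht₀.le) h1 2
    have ht20 : t₂ ≤ t₀ := le_trans hU (le_trans (mul_le_mul_of_nonneg_right hρR ht₁.le) hR0)
    have h2 : (t₀ - t₂) ^ 2 ≤ t₀ ^ 2 := sq_le_sq' (by linarith) (by linarith)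
    have c1 : KC * ((R - 1) ^ 2 * t₀ ^ 2) * t₂ ≤ KC * (R ^ 2 * (t₀ - t₁) ^ 2) * t₂ := by
      have : (R - 1) ^ 2 * t₀ ^ 2 ≤ R ^ 2 * (t₀ - t₁) ^ 2 := by
        have e1 : (R - 1) ^ 2 * t₀ ^ 2 = ((R - 1) * t₀) ^ 2 := by ring
        have e2 : R ^ 2 * (t₀ - t₁) ^ 2 = (R * (t₀ - t₁)) ^ 2 := by ring
        rw [e1, e2]; exact h1'
      exact mul_le_mul_of_nonneg_right (mul_le_mul_of_nonneg_left this hKC0.le) ht₂.le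
    have c2 : KC * (R ^ 2 * (t₀ - t₁) ^ 2) * t₂ ≤ R ^ 2 * (t₀ ^ 2 * t₁) := by
      have c2a : R ^ 2 * (KC * ((t₀ - t₁) ^ 2 * t₂)) ≤ R ^ 2 * ((t₀ - t₂) ^ 2 * t₁) :=
        mul_le_mul_of_nonneg_left hC (sq_nonneg R)
      have c2b : R ^ 2 * ((t₀ - t₂) ^ 2 * t₁) ≤ R ^ 2 * (t₀ ^ 2 * t₁) :=
        mul_le_mul_of_nonneg_left (mul_le_mul_of_nonneg_right h2 ht₁.le) (sq_nonneg R)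
      have e : KC * (R ^ 2 * (t₀ - t₁) ^ 2) * t₂ = R ^ 2 * (KC * ((t₀ - t₁) ^ 2 * t₂)) := by ring
      rw [e]; exact c2a.trans c2b
    have c3 : R ^ 2 * (t₀ ^ 2 * t₁) ≤ R ^ 2 * (t₀ ^ 2 * (ρ * t₂)) :=
      mul_le_mul_of_nonneg_left (mul_le_mul_of_nonneg_left hL (sq_nonneg t₀)) (sq_nonneg R)
    have c4 : KC * (R - 1) ^ 2 * (t₀ ^ 2 * t₂) ≤ ρ * R ^ 2 * (t₀ ^ 2 * t₂) := by
      have h := c1.trans (c2.trans c3)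
      calc KC * (R - 1) ^ 2 * (t₀ ^ 2 * t₂) = KC * ((R - 1) ^ 2 * t₀ ^ 2) * t₂ := by ring
        _ ≤ R ^ 2 * (t₀ ^ 2 * (ρ * t₂)) := h
        _ = ρ * R ^ 2 * (t₀ ^ 2 * t₂) := by ring
    have hpos2 : 0 < t₀ ^ 2 * t₂ := by positivity
    have c5 : KC * (R - 1) ^ 2 ≤ ρ * R ^ 2 := le_of_mul_le_mul_right c4 hpos2
    linarith
  · -- t₀ < t₁, so t₁ ≥ R t₀
    have hpos : 0 < R * t₁ - t₀ := by linarith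
    have hR0 : R * t₀ ≤ t₁ := by
      by_contra h
      push Not at h
      nlinarith [mul_pos (by linarith : 0 < R * t₀ - t₁) hpos]
    have h1 : (R - 1) * t₁ ≤ R * (t₁ - t₀) := by linarith
    have h1' : ((R - 1) * t₁) ^ 2 ≤ (R * (t₁ - t₀)) ^ 2 :=
      pow_le_pow_left₀ (mul_nonneg (by linarith) ht₁.le) h1 2
    -- here t₀ ≤ t₁/R ≤ t₁/ρ ≤ t₂, so (t₀ − t₂)² ≤ t₂²
    have ht02 : t₀ ≤ t₂ := by
      have hRt : R * t₀ ≤ R * t₂ := by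
        calc R * t₀ ≤ t₁ := hR0
          _ ≤ ρ * t₂ := hL
          _ ≤ R * t₂ := mul_le_mul_of_nonneg_right hρR ht₂.le
      exact le_of_mul_le_mul_left hRt (by linarith)
    have h2 : (t₀ - t₂) ^ 2 ≤ t₂ ^ 2 := sq_le_sq' (by linarith) (by linarith)
    have c1 : KC * ((R - 1) ^ 2 * t₁ ^ 2) * t₂ ≤ KC * (R ^ 2 * (t₀ - t₁) ^ 2) * t₂ := by
      have : (R - 1) ^ 2 * t₁ ^ 2 ≤ R ^ 2 * (t₀ - t₁) ^ 2 := by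
        have e1 : (R - 1) ^ 2 * t₁ ^ 2 = ((R - 1) * t₁) ^ 2 := by ring
        have e2 : R ^ 2 * (t₀ - t₁) ^ 2 = (R * (t₁ - t₀)) ^ 2 := by ring
        rw [e1, e2]; exact h1'
      exact mul_le_mul_of_nonneg_right (mul_le_mul_of_nonneg_left this hKC0.le) ht₂.le
    have c2 : KC * (R ^ 2 * (t₀ - t₁) ^ 2) * t₂ ≤ R ^ 2 * (t₂ ^ 2 * t₁) := by
      have c2a : R ^ 2 * (KC * ((t₀ - t₁) ^ 2 * t₂)) ≤ R ^ 2 * ((t₀ - t₂) ^ 2 * t₁) :=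
        mul_le_mul_of_nonneg_left hC (sq_nonneg R)
      have c2b : R ^ 2 * ((t₀ - t₂) ^ 2 * t₁) ≤ R ^ 2 * (t₂ ^ 2 * t₁) :=
        mul_le_mul_of_nonneg_left (mul_le_mul_of_nonneg_right h2 ht₁.le) (sq_nonneg R)
      have e : KC * (R ^ 2 * (t₀ - t₁) ^ 2) * t₂ = R ^ 2 * (KC * ((t₀ - t₁) ^ 2 * t₂)) := by ring
      rw [e]; exact c2a.trans c2b
    have c4 : KC * (R - 1) ^ 2 * t₁ * (t₁ * t₂) ≤ R ^ 2 * t₂ * (t₁ * t₂) := by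
      have h := c1.trans c2
      calc KC * (R - 1) ^ 2 * t₁ * (t₁ * t₂) = KC * ((R - 1) ^ 2 * t₁ ^ 2) * t₂ := by ring
        _ ≤ R ^ 2 * (t₂ ^ 2 * t₁) := h
        _ = R ^ 2 * t₂ * (t₁ * t₂) := by ring
    have hpos2 : 0 < t₁ * t₂ := by positivity
    have c5 : KC * (R - 1) ^ 2 * t₁ ≤ R ^ 2 * t₂ := le_of_mul_le_mul_right c4 hpos2
    have c6 : R ^ 2 * t₂ ≤ R ^ 2 * (ρ * t₁) := mul_le_mul_of_nonneg_left hU (sq_nonneg R)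
    nlinarith [mul_lt_mul_of_pos_right hKC ht₁]

end Summit.ValiantsHypothesis.ValiantsHypothesis.Theorems.LacunarySymmetroidMatrixDescartes.Pivot.TwoDirections.BlockLaw
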